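import Summits.NavierStokesRegularity.NavierStokesRegularity.Theorems.PalasekTowerBreakdownEpisodeBaseStrainPairingLevelTwo

/-!
# Strain-currency pairing lemmas, Part IV: the level-2 (`H²`) STRETCHING term

Cell `ns-blowup`, seat `ns-palasek-19179-p2` (g6; holder-of-record lineage of crux
stmt-NavierStokesRegularity-19179 `EpisodeBase`, route `PalasekTowerBreakdown`; `--supports
stmt-NavierStokesRegularity-19179`). Sequel of Parts I–III for the stub `stub_strain_door : StrainDoor` of the
strategist line `Cruxes/EpisodeBase/Lines/straindoor.lean` (cstrat-19179, v2). LABEL: E–C analysis (KERNEL: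
theorems only; no definition, no named fact, no `sorry`; register-free). WHAT THIS IS NOT: not Navier–Stokes
evidence — whole-space calculus bounds for two given fields; no flow, run, design or blow-up is exhibited or asserted.

## What is proved (`u : E → E` the reference with bounded derivatives, `v : E → E` a smooth `L²` field, `b` the
standard orthonormal basis, `Vₗ = ∂ₗv`, `Uₗ = ∂ₗu`)

* `norm_fderiv_fderiv_apply_le` — `‖D(∂ₗu)(x) w‖ ≤ ‖D²u(x)‖ ‖w‖` for unit `bₗ`.
* **`abs_sum_integral_inner_fderiv_convect_laplacian_le_stretching`** (level 2, STRETCHING):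
  `|∑ₗ ∫ ⟪∂ₗ[(v·∇)u], ΔVₗ⟫| ≤ σ ∑ₗ∑ₖ ∫‖∂ₖVₗ‖² + σ₂ ∑ₗ ∫ ‖Vₗ‖ ∑ₖ‖∂ₖVₗ‖ + σ₂ ∑ₗ∑ₖ ∫ ‖∂ₖv‖ ‖∂ₖVₗ‖
   + σ₃ ∑ₗ∑ₖ ∫ ‖v‖ ‖∂ₖVₗ‖`
  under the strain majorant `|⟪Du(x)ξ, ξ⟫| ≤ σ‖ξ‖²`, `‖D²u‖ ≤ σ₂` and `‖D(D(∂ₗu))‖ ≤ σ₃` — ONE strain unit: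
  `∂ₗ[(v·∇)u] = (Vₗ·∇)u + (v·∇)Uₗ`; the first term is the level-1 stretching of `Vₗ` (Part II); the second is the
  two-field identity of Part III with `w = Uₗ` (only `σ₂`, `σ₃` cross terms).
LEDGER of the series: pure-strain coefficients of the three trilinear pairings are `σ` (level 0), `σ + σ = 2σ`
(level 1: transport + stretching), `2σ + σ = 3σ` (level 2); doubled by `d/dt ‖·‖² = 2⟪∂ₜ·, ·⟫` this is the card's
`6σ` at the top level, with every other term carrying `σ₂` or `σ₃`.

References: P. Constantin, C. Foias, *Navier–Stokes Equations*, 1988, Ch. 10 [cite: ConstantinFoiasNSE1988, Ch. 10 Thm. 10.2];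
C. R. Doering, J. D. Gibbon, CUP 1995, §2.3 [cite: DoeringGibbon1995, §2.3 (2.3.29)–(2.3.31)].
-/

noncomputable section

set_option linter.dupNamespace false

open MeasureTheory Filter Function Set
open scoped ENNReal NNReal RealInnerProductSpace Topology Laplacian
open Literature.Analysis.FunctionSpaces Literature.Analysis.FluidPDE

namespace Summit.NavierStokesRegularity.NavierStokesRegularity.Theorems.StrainPairing

variable {E : Type*} [NormedAddCommGroup E] [InnerProductSpace ℝ E] [FiniteDimensional ℝ E]
  [MeasurableSpace E] [BorelSpace E]

/-! ## Level 2: the stretching term -/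

section LevelTwoStretching

omit [MeasurableSpace E] [BorelSpace E] in
/-- `D(∂ₗu)(x) w = D²u(x) w bₗ`, hence `‖D(∂ₗu)(x) w‖ ≤ ‖D²u(x)‖ ‖w‖` for the unit vector `bₗ`.
[cite: ConstantinFoiasNSE1988, Ch. 10 Thm. 10.2] -/
theorem norm_fderiv_fderiv_apply_le {u : E → E} (hu : ContDiff ℝ 2 u) (x w : E)
    (l : Fin (Module.finrank ℝ E)) :
    ‖fderiv ℝ (fun y => fderiv ℝ u y (stdOrthonormalBasis ℝ E l)) x w‖ ≤ ‖fderiv ℝ (fderiv ℝ u) x‖ * ‖w‖ := by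
  set b := stdOrthonormalBasis ℝ E with hb
  have hdu : DifferentiableAt ℝ (fderiv ℝ u) x :=
    ((hu.fderiv_right (m := 1) le_rfl).differentiable one_ne_zero) x
  rw [fderiv_clm_apply hdu (differentiableAt_const (b l))]
  simp only [fderiv_fun_const, Pi.zero_apply, ContinuousLinearMap.comp_zero, zero_add,
    ContinuousLinearMap.flip_apply]
  calc ‖fderiv ℝ (fderiv ℝ u) x w (b l)‖ ≤ ‖fderiv ℝ (fderiv ℝ u) x w‖ * ‖b l‖ := ContinuousLinearMap.le_opNorm _ _
    _ ≤ ‖fderiv ℝ (fderiv ℝ u) x‖ * ‖w‖ * ‖b l‖ := by gcongr; exact ContinuousLinearMap.le_opNorm _ _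
    _ = ‖fderiv ℝ (fderiv ℝ u) x‖ * ‖w‖ := by rw [b.orthonormal.1 l, mul_one]

/-- **Level 2, stretching BOUND in strain currency.** For a reference `u : E → E` with bounded derivatives,
`|⟪Du(x)ξ, ξ⟫| ≤ σ‖ξ‖²`, `‖D²u(x)‖ ≤ σ₂`, `‖D(D(∂ₗu))(x)‖ ≤ σ₃`, and a smooth `L²` field `v : E → E` (`Vₗ = ∂ₗv`):
`|∑ₗ ∫ ⟪∂ₗ[(v·∇)u], ΔVₗ⟫| ≤ σ ∑ₗ∑ₖ ∫‖∂ₖVₗ‖² + σ₂ ∑ₗ ∫ ‖Vₗ‖ ∑ₖ‖∂ₖVₗ‖ + σ₂ ∑ₗ∑ₖ ∫ ‖∂ₖv‖‖∂ₖVₗ‖ + σ₃ ∑ₗ∑ₖ ∫ ‖v‖‖∂ₖVₗ‖`.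
[cite: ConstantinFoiasNSE1988, Ch. 10 Thm. 10.2] [cite: DoeringGibbon1995, §2.3 (2.3.29)–(2.3.31)] -/
theorem abs_sum_integral_inner_fderiv_convect_laplacian_le_stretching {u v : E → E}
    (hu : HasBoundedDerivs u) (hv : IsSmoothL2Field v) {σ σ₂ σ₃ : ℝ}
    (hσ : ∀ x ξ : E, |⟪fderiv ℝ u x ξ, ξ⟫| ≤ σ * ‖ξ‖ ^ 2)
    (hσ₂ : ∀ x, ‖fderiv ℝ (fderiv ℝ u) x‖ ≤ σ₂)
    (hσ₃ : ∀ (l : Fin (Module.finrank ℝ E)) x,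
      ‖fderiv ℝ (fderiv ℝ (fun y => fderiv ℝ u y (stdOrthonormalBasis ℝ E l))) x‖ ≤ σ₃) :
    |∑ l, ∫ x, ⟪fderiv ℝ (convect v u) x (stdOrthonormalBasis ℝ E l),
        (Δ (fun y => fderiv ℝ v y (stdOrthonormalBasis ℝ E l))) x⟫| ≤
      σ * (∑ l, ∑ k, ∫ x, ‖fderiv ℝ (fun y => fderiv ℝ v y (stdOrthonormalBasis ℝ E l)) x
          (stdOrthonormalBasis ℝ E k)‖ ^ 2) +
        σ₂ * (∑ l, ∫ x, ‖fderiv ℝ v x (stdOrthonormalBasis ℝ E l)‖ *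
          ∑ k, ‖fderiv ℝ (fun y => fderiv ℝ v y (stdOrthonormalBasis ℝ E l)) x (stdOrthonormalBasis ℝ E k)‖) +
        σ₂ * (∑ l, ∑ k, ∫ x, ‖fderiv ℝ v x (stdOrthonormalBasis ℝ E k)‖ *
          ‖fderiv ℝ (fun y => fderiv ℝ v y (stdOrthonormalBasis ℝ E l)) x (stdOrthonormalBasis ℝ E k)‖) +
        σ₃ * (∑ l, ∑ k, ∫ x, ‖v x‖ *
          ‖fderiv ℝ (fun y => fderiv ℝ v y (stdOrthonormalBasis ℝ E l)) x (stdOrthonormalBasis ℝ E k)‖) := by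
  set b := stdOrthonormalBasis ℝ E with hb
  have hu2 : ContDiff ℝ 2 u := hu.contDiff_nat 2
  have hv1 : ContDiff ℝ 1 v := hv.contDiff_nat 1
  -- the fields `Vₗ = ∂ₗ v` (smooth `L²`) and `Uₗ = ∂ₗ u` (bounded derivatives)
  set V : Fin (Module.finrank ℝ E) → E → E := fun l y => fderiv ℝ v y (b l) with hV
  set U : Fin (Module.finrank ℝ E) → E → E := fun l y => fderiv ℝ u y (b l) with hU
  have hVS : ∀ l, IsSmoothL2Field (V l) := fun l => hv.fderiv_apply (b l)
  have hUS : ∀ l, HasBoundedDerivs (U l) := fun l => hu.fderiv_apply (b l)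
  -- `∂ₗ[(v·∇)u] = (Vₗ·∇)u + (v·∇)Uₗ`
  have hsplit : ∀ l x, fderiv ℝ (convect v u) x (b l) = convect (V l) u x + convect v (U l) x := by
    intro l x; rw [fderiv_convect_apply hv1 hu2 x (b l)]; rfl
  -- pointwise operator bounds for `Uₗ`
  have hU1 : ∀ l x w, ‖fderiv ℝ (U l) x w‖ ≤ σ₂ * ‖w‖ := fun l x w =>
    (norm_fderiv_fderiv_apply_le hu2 x w l).trans (mul_le_mul_of_nonneg_right (hσ₂ x) (norm_nonneg _))
  have hU2 : ∀ l k x, ‖fderiv ℝ (fderiv ℝ (U l)) x (b k) (v x)‖ ≤ σ₃ * ‖v x‖ := by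
    intro l k x
    calc ‖fderiv ℝ (fderiv ℝ (U l)) x (b k) (v x)‖ ≤ ‖fderiv ℝ (fderiv ℝ (U l)) x (b k)‖ * ‖v x‖ :=
          ContinuousLinearMap.le_opNorm _ _
      _ ≤ ‖fderiv ℝ (fderiv ℝ (U l)) x‖ * ‖b k‖ * ‖v x‖ := by gcongr; exact ContinuousLinearMap.le_opNorm _ _
      _ ≤ σ₃ * ‖v x‖ := by
          rw [b.orthonormal.1 k, mul_one]; exact mul_le_mul_of_nonneg_right (hσ₃ l x) (norm_nonneg _)
  -- L² memberships of the two-field summands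
  have hm1 : ∀ l k, MemLp (fun x => fderiv ℝ (U l) x (fderiv ℝ v x (b k))) 2 volume := by
    intro l k
    refine MemLp.of_le_mul (c := σ₂) ((hv.fderiv_apply (b k)).memLp_two) ?_
      (Eventually.of_forall fun x => hU1 l x _)
    exact ((((hUS l).contDiff_nat 1).continuous_fderiv one_ne_zero).clm_apply
      ((hv1.continuous_fderiv one_ne_zero).clm_apply continuous_const)).aestronglyMeasurable
  have hm2 : ∀ l k, MemLp (fun x => fderiv ℝ (fderiv ℝ (U l)) x (b k) (v x)) 2 volume := by
    intro l k
    refine MemLp.of_le_mul (c := σ₃) hv.memLp_two ?_ (Eventually.of_forall fun x => hU2 l k x)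
    exact (((((hUS l).contDiff_nat 2).fderiv_right (m := 1) le_rfl).continuous_fderiv one_ne_zero).clm_apply
      continuous_const).clm_apply hv.continuous |>.aestronglyMeasurable
  have hcr1 : ∀ l k, Integrable (fun x => ‖fderiv ℝ v x (b k)‖ * ‖fderiv ℝ (V l) x (b k)‖) volume :=
    fun l k => (hv.fderiv_apply (b k)).memLp_two.norm.integrable_mul (((hVS l).fderiv_apply (b k)).memLp_two.norm)
  have hcr2 : ∀ l k, Integrable (fun x => ‖v x‖ * ‖fderiv ℝ (V l) x (b k)‖) volume :=
    fun l k => hv.memLp_two.norm.integrable_mul (((hVS l).fderiv_apply (b k)).memLp_two.norm)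
  -- TERM C: level-1 stretching of `Vₗ`
  have hC : ∀ l, |∫ x, ⟪convect (V l) u x, (Δ (V l)) x⟫| ≤
      σ * (∑ k, ∫ x, ‖fderiv ℝ (V l) x (b k)‖ ^ 2) + σ₂ * ∫ x, ‖V l x‖ * ∑ k, ‖fderiv ℝ (V l) x (b k)‖ :=
    fun l => abs_integral_inner_convect_laplacian_le_of_strain_of_hess hu (hVS l) hσ hσ₂
  -- TERM D: the two-field identity with `w = Uₗ`
  have hD : ∀ l, |∫ x, ⟪convect v (U l) x, (Δ (V l)) x⟫| ≤
      σ₂ * (∑ k, ∫ x, ‖fderiv ℝ v x (b k)‖ * ‖fderiv ℝ (V l) x (b k)‖) +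
        σ₃ * ∑ k, ∫ x, ‖v x‖ * ‖fderiv ℝ (V l) x (b k)‖ := by
    intro l
    rw [integral_inner_convect_laplacian_eq_two_field (hUS l) hv (hVS l)]
    set D₁ := ∑ k, ∫ x, ⟪fderiv ℝ (U l) x (fderiv ℝ v x (b k)), fderiv ℝ (V l) x (b k)⟫ with hD₁
    set D₂ := ∑ k, ∫ x, ⟪fderiv ℝ (fderiv ℝ (U l)) x (b k) (v x), fderiv ℝ (V l) x (b k)⟫ with hD₂
    have h1 : |D₁| ≤ σ₂ * ∑ k, ∫ x, ‖fderiv ℝ v x (b k)‖ * ‖fderiv ℝ (V l) x (b k)‖ := by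
      rw [hD₁, Finset.mul_sum]
      refine (Finset.abs_sum_le_sum_abs _ _).trans (Finset.sum_le_sum fun k _ => ?_)
      rw [← integral_const_mul]
      refine (abs_integral_le_integral_abs).trans
        (integral_mono_of_nonneg (Eventually.of_forall fun x => abs_nonneg _) ((hcr1 l k).const_mul σ₂)
          (Eventually.of_forall fun x => ?_))
      calc |⟪fderiv ℝ (U l) x (fderiv ℝ v x (b k)), fderiv ℝ (V l) x (b k)⟫|
          ≤ ‖fderiv ℝ (U l) x (fderiv ℝ v x (b k))‖ * ‖fderiv ℝ (V l) x (b k)‖ := abs_real_inner_le_norm _ _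
        _ ≤ (σ₂ * ‖fderiv ℝ v x (b k)‖) * ‖fderiv ℝ (V l) x (b k)‖ := by gcongr; exact hU1 l x _
        _ = σ₂ * (‖fderiv ℝ v x (b k)‖ * ‖fderiv ℝ (V l) x (b k)‖) := by ring
    have h2 : |D₂| ≤ σ₃ * ∑ k, ∫ x, ‖v x‖ * ‖fderiv ℝ (V l) x (b k)‖ := by
      rw [hD₂, Finset.mul_sum]
      refine (Finset.abs_sum_le_sum_abs _ _).trans (Finset.sum_le_sum fun k _ => ?_)
      rw [← integral_const_mul]
      refine (abs_integral_le_integral_abs).trans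
        (integral_mono_of_nonneg (Eventually.of_forall fun x => abs_nonneg _) ((hcr2 l k).const_mul σ₃)
          (Eventually.of_forall fun x => ?_))
      calc |⟪fderiv ℝ (fderiv ℝ (U l)) x (b k) (v x), fderiv ℝ (V l) x (b k)⟫|
          ≤ ‖fderiv ℝ (fderiv ℝ (U l)) x (b k) (v x)‖ * ‖fderiv ℝ (V l) x (b k)‖ := abs_real_inner_le_norm _ _
        _ ≤ (σ₃ * ‖v x‖) * ‖fderiv ℝ (V l) x (b k)‖ := by gcongr; exact hU2 l k x
        _ = σ₃ * (‖v x‖ * ‖fderiv ℝ (V l) x (b k)‖) := by ring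
    have e : -D₁ - D₂ = -(D₁ + D₂) := by ring
    rw [e, abs_neg]
    exact (abs_add_le _ _).trans (add_le_add h1 h2)
  -- assembly
  have hsum : ∑ l, ∫ x, ⟪fderiv ℝ (convect v u) x (b l), (Δ (V l)) x⟫ =
      ∑ l, ((∫ x, ⟪convect (V l) u x, (Δ (V l)) x⟫) + ∫ x, ⟪convect v (U l) x, (Δ (V l)) x⟫) := by
    refine Finset.sum_congr rfl fun l _ => ?_
    simp_rw [hsplit l, inner_add_left]
    -- integrability of the two pairings: `(Vₗ·∇)u = Du(Vₗ)` and `(v·∇)Uₗ = DUₗ(v)` are in `L²`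
    obtain ⟨M₁, hM₁⟩ := hu.exists_norm_fderiv_le
    have hmC : MemLp (convect (V l) u) 2 volume := by
      refine MemLp.of_le_mul (c := M₁) (hVS l).memLp_two ?_ (Eventually.of_forall fun x => ?_)
      · exact ((hu2.continuous_fderiv (by norm_num)).clm_apply (hVS l).continuous).aestronglyMeasurable
      · rw [convect_apply]
        exact (ContinuousLinearMap.le_opNorm _ _).trans (mul_le_mul_of_nonneg_right (hM₁ x) (norm_nonneg _))
    have hmD : MemLp (convect v (U l)) 2 volume := by
      refine MemLp.of_le_mul (c := σ₂) hv.memLp_two ?_ (Eventually.of_forall fun x => ?_)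
      · exact ((((hUS l).contDiff_nat 1).continuous_fderiv one_ne_zero).clm_apply hv.continuous).aestronglyMeasurable
      · rw [convect_apply]; exact hU1 l x _
    exact integral_add (integrable_inner_of_memLp_two hmC (hVS l).laplacian.memLp_two)
      (integrable_inner_of_memLp_two hmD (hVS l).laplacian.memLp_two)
  rw [hsum]
  calc |∑ l, ((∫ x, ⟪convect (V l) u x, (Δ (V l)) x⟫) + ∫ x, ⟪convect v (U l) x, (Δ (V l)) x⟫)|
      ≤ ∑ l, (|∫ x, ⟪convect (V l) u x, (Δ (V l)) x⟫| + |∫ x, ⟪convect v (U l) x, (Δ (V l)) x⟫|) :=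
        (Finset.abs_sum_le_sum_abs _ _).trans (Finset.sum_le_sum fun l _ => abs_add_le _ _)
    _ ≤ ∑ l, ((σ * (∑ k, ∫ x, ‖fderiv ℝ (V l) x (b k)‖ ^ 2) +
          σ₂ * ∫ x, ‖V l x‖ * ∑ k, ‖fderiv ℝ (V l) x (b k)‖) +
          (σ₂ * (∑ k, ∫ x, ‖fderiv ℝ v x (b k)‖ * ‖fderiv ℝ (V l) x (b k)‖) +
            σ₃ * ∑ k, ∫ x, ‖v x‖ * ‖fderiv ℝ (V l) x (b k)‖)) :=
        Finset.sum_le_sum fun l _ => add_le_add (hC l) (hD l)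
    _ = _ := by
        simp only [Finset.sum_add_distrib, ← Finset.mul_sum, hV]
        ring

end LevelTwoStretching

end Summit.NavierStokesRegularity.NavierStokesRegularity.Theorems.StrainPairing

end
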